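import Mathlib
import Literature.Analysis.FluidPDE.LeraySeparationOfEnergyTools
import Summits.NavierStokesRegularity.NavierStokesRegularity.Theorems.EulerZoomLiouvillePowerGaugeEulerLiouvilleEnergySaturationShell

/-!
# THE WAITING ROOM IS THIN: Chebyshev on the profile `E`-gauge (ROUND-40 (K3), nsreg-p2 g33 §2/§4 (D2))

Width piece for crux `EulerZoomLiouville.PowerGaugeEulerLiouville` (stmt-NavierStokesRegularity-19832), by name under
LEAD 19832 (ns-typeII-p2 g12); seat ns-in-ser-c g3 (director-ns inputs-36), `--supports stmt-NavierStokesRegularity-19832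
--as helper`.

ROUND-40's compression criterion (K2′, from t40c `NeedleClock.norm_fderiv_flow_sq_ge_linger` + Grönwall) says a lingering
vortical label must spend a definite fraction of its backward time where the profile gradient is LARGE
(`−λ_min(sym DU) ≥ 1/4`, in particular `‖DU‖ ≥ 1/4`).  This file is the other half, (K3): that set is THIN, by Chebyshev on
the `E`-gauge of the class read in profile variables (`profile_gradient_weight_of_gaugeE`: `∫ |∇U|²_F |y|^{ρ−1} ≤ ((1−ρ)/(2+ρ))c`,
ball form `EnergySaturation.lintegral_ball_frobenius_le_of_weight`: `∫_{B_L} |∇U|²_F ≤ L^{1−ρ}·C`).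

* `ofReal_sq_mul_volume_opNorm_fderiv_ge_le` — CHEBYSHEV: for `U ∈ C¹` and `q > 0`,
  `q² · vol({z | q ≤ ‖DU(z)‖} ∩ B_L) ≤ ∫_{B_L} |DU|²_F` (`‖A‖² ≤ |A|²_F`, Markov);
* `ofReal_sq_mul_volume_opNorm_fderiv_ge_le_of_weight` — with the `E`-WEIGHT: `… ≤ L^{1−ρ}·C` (`0 < L`, `ρ < 1`);
* `volume_compressionSet_le_of_weight` / `volume_stretchingSet_le_of_weight` — the HIGH-COMPRESSION set
  `{z | ∃ v, ⟪DU(z)v, v⟫ < −q‖v‖²}` (the complement of t40d's hypothesis `hk`) and the HIGH-STRETCHING set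
  `{z | ∃ v, q‖v‖² < ⟪DU(z)v, v⟫}` (complement of `hs`) lie inside `{q ≤ ‖DU‖}`, hence have volume `≤ q^{−2} L^{1−ρ} C` in `B_L`
  — THIN against `|B_L| ~ L³`.

HONEST FRAMING: elementary measure bookkeeping for HYPOTHETICAL self-similar Euler profiles; it proves nothing about the crux E
(19832 OPEN), any door Target, or Navier–Stokes regularity; no summit statement is touched. [folklore (Chebyshev–Markov)]
-/

noncomputable section

open Set Filter Topology Metric Function MeasureTheory
open scoped RealInnerProductSpace NNReal ENNReal

set_option linter.dupNamespace false

namespace Summit.NavierStokesRegularity.NavierStokesRegularity.Theorems.PowerGaugeEulerLiouville.NeedleClock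

open Literature.Analysis Literature.Analysis.FluidPDE
open Summit.NavierStokesRegularity.NavierStokesRegularity.Theorems.PowerGaugeEulerLiouville

variable {U : EuclideanSpace ℝ (Fin 3) → EuclideanSpace ℝ (Fin 3)}

/-- **Chebyshev on the profile gradient.**  For `U ∈ C¹`, `q > 0` and any radius `L`:
`q² · vol({z | q ≤ ‖DU(z)‖} ∩ B_L) ≤ ∫_{B_L} |DU|²_F` (Markov's inequality for `|DU|²_F ≥ ‖DU‖² ≥ q²` on the set).
[folklore] -/
theorem ofReal_sq_mul_volume_opNorm_fderiv_ge_le (hU : ContDiff ℝ 1 U) {q : ℝ} (hq : 0 < q) (L : ℝ) :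
    ENNReal.ofReal (q ^ 2) *
        volume ({z : EuclideanSpace ℝ (Fin 3) | q ≤ ‖fderiv ℝ U z‖} ∩ ball (0 : EuclideanSpace ℝ (Fin 3)) L) ≤
      ∫⁻ z in ball (0 : EuclideanSpace ℝ (Fin 3)) L, ENNReal.ofReal (frobeniusNormSq (fderiv ℝ U z)) := by
  have hcont : Continuous fun z => fderiv ℝ U z := hU.continuous_fderiv one_ne_zero
  have hFc : Continuous fun z => frobeniusNormSq (fderiv ℝ U z) :=
    LerayHopfProofs.continuous_frobeniusNormSq.comp hcont
  have hfm : AEMeasurable (fun z => ENNReal.ofReal (frobeniusNormSq (fderiv ℝ U z)))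
      (volume.restrict (ball (0 : EuclideanSpace ℝ (Fin 3)) L)) :=
    hFc.measurable.ennreal_ofReal.aemeasurable
  have hS : MeasurableSet {z : EuclideanSpace ℝ (Fin 3) | q ≤ ‖fderiv ℝ U z‖} :=
    (isClosed_le continuous_const hcont.norm).measurableSet
  have hmarkov := mul_meas_ge_le_lintegral₀ hfm (ENNReal.ofReal (q ^ 2))
  have hsub : {z : EuclideanSpace ℝ (Fin 3) | q ≤ ‖fderiv ℝ U z‖} ∩ ball (0 : EuclideanSpace ℝ (Fin 3)) L ⊆
      {z | ENNReal.ofReal (q ^ 2) ≤ ENNReal.ofReal (frobeniusNormSq (fderiv ℝ U z))} ∩ ball 0 L := by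
    rintro z ⟨hz, hzL⟩
    refine ⟨?_, hzL⟩
    refine ENNReal.ofReal_le_ofReal ?_
    calc q ^ 2 ≤ ‖fderiv ℝ U z‖ ^ 2 := by gcongr; exact hz
      _ ≤ frobeniusNormSq (fderiv ℝ U z) := norm_sq_le_frobeniusNormSq _
  calc ENNReal.ofReal (q ^ 2) *
        volume ({z : EuclideanSpace ℝ (Fin 3) | q ≤ ‖fderiv ℝ U z‖} ∩ ball (0 : EuclideanSpace ℝ (Fin 3)) L)
      ≤ ENNReal.ofReal (q ^ 2) *
        volume ({z | ENNReal.ofReal (q ^ 2) ≤ ENNReal.ofReal (frobeniusNormSq (fderiv ℝ U z))} ∩ ball 0 L) := by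
          gcongr
    _ = ENNReal.ofReal (q ^ 2) * (volume.restrict (ball (0 : EuclideanSpace ℝ (Fin 3)) L))
        {z | ENNReal.ofReal (q ^ 2) ≤ ENNReal.ofReal (frobeniusNormSq (fderiv ℝ U z))} := by
          rw [Measure.restrict_apply' measurableSet_ball]
    _ ≤ ∫⁻ z in ball (0 : EuclideanSpace ℝ (Fin 3)) L, ENNReal.ofReal (frobeniusNormSq (fderiv ℝ U z)) := hmarkov

/-- **Chebyshev with the `E`-weight (THE WAITING ROOM IS THIN).**  For `U ∈ C¹`, `ρ < 1`, the `E`-gauge of the class in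
profile variables `∫ |DU|²_F |y|^{ρ−1} ≤ C` (output of `profile_gradient_weight_of_gaugeE`), `q > 0`, `L > 0`:
`q² · vol({z | q ≤ ‖DU(z)‖} ∩ B_L) ≤ L^{1−ρ} · C`. [folklore] -/
theorem ofReal_sq_mul_volume_opNorm_fderiv_ge_le_of_weight (hU : ContDiff ℝ 1 U) {ρ : ℝ} (hρ1 : ρ < 1) {C : ℝ≥0∞}
    (hE : ∫⁻ y, ENNReal.ofReal (frobeniusNormSq (fderiv ℝ U y)) * ENNReal.ofReal (‖y‖ ^ (ρ - 1)) ≤ C)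
    {q : ℝ} (hq : 0 < q) {L : ℝ} (hL : 0 < L) :
    ENNReal.ofReal (q ^ 2) *
        volume ({z : EuclideanSpace ℝ (Fin 3) | q ≤ ‖fderiv ℝ U z‖} ∩ ball (0 : EuclideanSpace ℝ (Fin 3)) L) ≤
      ENNReal.ofReal (L ^ (1 - ρ)) * C :=
  (ofReal_sq_mul_volume_opNorm_fderiv_ge_le hU hq L).trans
    (EnergySaturation.lintegral_ball_frobenius_le_of_weight hρ1 hE hL)

/-- The HIGH-COMPRESSION set lies inside the large-gradient set: if `⟪DU(z)v, v⟫ < −q‖v‖²` for some `v` then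
`q ≤ ‖DU(z)‖` (Cauchy–Schwarz). [folklore] -/
theorem compressionSet_subset {q : ℝ} :
    {z : EuclideanSpace ℝ (Fin 3) | ∃ v : EuclideanSpace ℝ (Fin 3), ⟪fderiv ℝ U z v, v⟫ < -(q * ‖v‖ ^ 2)} ⊆
      {z | q ≤ ‖fderiv ℝ U z‖} := by
  rintro z ⟨v, hv⟩
  have hv0 : v ≠ 0 := by
    rintro rfl; simp at hv
  have hvn : 0 < ‖v‖ := norm_pos_iff.2 hv0
  have hcs : |⟪fderiv ℝ U z v, v⟫| ≤ ‖fderiv ℝ U z‖ * ‖v‖ * ‖v‖ :=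
    (abs_real_inner_le_norm _ _).trans (by gcongr; exact (fderiv ℝ U z).le_opNorm v)
  have h1 : q * ‖v‖ ^ 2 ≤ ‖fderiv ℝ U z‖ * ‖v‖ ^ 2 := by
    have := neg_abs_le ⟪fderiv ℝ U z v, v⟫
    nlinarith
  exact le_of_mul_le_mul_right (by nlinarith) (by positivity : 0 < ‖v‖ ^ 2)

/-- The HIGH-STRETCHING set lies inside the large-gradient set: if `q‖v‖² < ⟪DU(z)v, v⟫` for some `v` then
`q ≤ ‖DU(z)‖`. [folklore] -/
theorem stretchingSet_subset {q : ℝ} :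
    {z : EuclideanSpace ℝ (Fin 3) | ∃ v : EuclideanSpace ℝ (Fin 3), q * ‖v‖ ^ 2 < ⟪fderiv ℝ U z v, v⟫} ⊆
      {z | q ≤ ‖fderiv ℝ U z‖} := by
  rintro z ⟨v, hv⟩
  by_cases hv0 : v = 0
  · subst hv0
    simp at hv
  have hvn : 0 < ‖v‖ := norm_pos_iff.2 hv0
  have hcs : ⟪fderiv ℝ U z v, v⟫ ≤ ‖fderiv ℝ U z‖ * ‖v‖ * ‖v‖ :=
    (real_inner_le_norm _ _).trans (by gcongr; exact (fderiv ℝ U z).le_opNorm v)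
  have h1 : q * ‖v‖ ^ 2 ≤ ‖fderiv ℝ U z‖ * ‖v‖ ^ 2 := by nlinarith
  exact le_of_mul_le_mul_right (by nlinarith) (by positivity : 0 < ‖v‖ ^ 2)

/-- **The high-compression part of the waiting room is thin.**  Under the `E`-weight bound, for `q, L > 0`:
`q² · vol({z | ∃ v, ⟪DU(z)v, v⟫ < −q‖v‖²} ∩ B_L) ≤ L^{1−ρ} · C` — the set where t40d's compression hypothesis
`hk` (rate `q`) FAILS has volume `O(L^{1−ρ})`, against `|B_L| ~ L³`. [folklore] -/
theorem volume_compressionSet_le_of_weight (hU : ContDiff ℝ 1 U) {ρ : ℝ} (hρ1 : ρ < 1) {C : ℝ≥0∞}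
    (hE : ∫⁻ y, ENNReal.ofReal (frobeniusNormSq (fderiv ℝ U y)) * ENNReal.ofReal (‖y‖ ^ (ρ - 1)) ≤ C)
    {q : ℝ} (hq : 0 < q) {L : ℝ} (hL : 0 < L) :
    ENNReal.ofReal (q ^ 2) *
        volume ({z : EuclideanSpace ℝ (Fin 3) | ∃ v : EuclideanSpace ℝ (Fin 3), ⟪fderiv ℝ U z v, v⟫ < -(q * ‖v‖ ^ 2)} ∩
          ball (0 : EuclideanSpace ℝ (Fin 3)) L) ≤
      ENNReal.ofReal (L ^ (1 - ρ)) * C := by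
  exact le_trans (mul_le_mul' le_rfl (measure_mono (inter_subset_inter_left _ compressionSet_subset)))
    (ofReal_sq_mul_volume_opNorm_fderiv_ge_le_of_weight hU hρ1 hE hq hL)

/-- **The high-stretching part of the waiting room is thin.**  Under the `E`-weight bound, for `q, L > 0`:
`q² · vol({z | ∃ v, q‖v‖² < ⟪DU(z)v, v⟫} ∩ B_L) ≤ L^{1−ρ} · C` — the set where t40d's stretching hypothesis `hs`
(rate `q`) FAILS has volume `O(L^{1−ρ})`. [folklore] -/
theorem volume_stretchingSet_le_of_weight (hU : ContDiff ℝ 1 U) {ρ : ℝ} (hρ1 : ρ < 1) {C : ℝ≥0∞}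
    (hE : ∫⁻ y, ENNReal.ofReal (frobeniusNormSq (fderiv ℝ U y)) * ENNReal.ofReal (‖y‖ ^ (ρ - 1)) ≤ C)
    {q : ℝ} (hq : 0 < q) {L : ℝ} (hL : 0 < L) :
    ENNReal.ofReal (q ^ 2) *
        volume ({z : EuclideanSpace ℝ (Fin 3) | ∃ v : EuclideanSpace ℝ (Fin 3), q * ‖v‖ ^ 2 < ⟪fderiv ℝ U z v, v⟫} ∩
          ball (0 : EuclideanSpace ℝ (Fin 3)) L) ≤
      ENNReal.ofReal (L ^ (1 - ρ)) * C := by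
  exact le_trans (mul_le_mul' le_rfl (measure_mono (inter_subset_inter_left _ stretchingSet_subset)))
    (ofReal_sq_mul_volume_opNorm_fderiv_ge_le_of_weight hU hρ1 hE hq hL)

/-- **Thin waiting room, real-valued form.**  With a real constant `c` in the `E`-weight bound:
`vol({z | q ≤ ‖DU(z)‖} ∩ B_L) ≤ c · L^{1−ρ} / q²`. [folklore] -/
theorem volume_opNorm_fderiv_ge_le_of_weight (hU : ContDiff ℝ 1 U) {ρ : ℝ} (hρ1 : ρ < 1) {c : ℝ}
    (hE : ∫⁻ y, ENNReal.ofReal (frobeniusNormSq (fderiv ℝ U y)) * ENNReal.ofReal (‖y‖ ^ (ρ - 1)) ≤ ENNReal.ofReal c)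
    {q : ℝ} (hq : 0 < q) {L : ℝ} (hL : 0 < L) :
    volume ({z : EuclideanSpace ℝ (Fin 3) | q ≤ ‖fderiv ℝ U z‖} ∩ ball (0 : EuclideanSpace ℝ (Fin 3)) L) ≤
      ENNReal.ofReal (c * L ^ (1 - ρ) / q ^ 2) := by
  have h := ofReal_sq_mul_volume_opNorm_fderiv_ge_le_of_weight hU hρ1 hE hq hL
  have hq2 : 0 < q ^ 2 := by positivity
  rw [← ENNReal.ofReal_mul (by positivity)] at h
  have h' : volume ({z : EuclideanSpace ℝ (Fin 3) | q ≤ ‖fderiv ℝ U z‖} ∩ ball (0 : EuclideanSpace ℝ (Fin 3)) L) ≤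
      ENNReal.ofReal (L ^ (1 - ρ) * c) / ENNReal.ofReal (q ^ 2) := by
    rw [ENNReal.le_div_iff_mul_le (Or.inl ((ENNReal.ofReal_pos.2 hq2).ne')) (Or.inl ENNReal.ofReal_ne_top), mul_comm]
    exact h
  refine h'.trans (le_of_eq ?_)
  rw [← ENNReal.ofReal_div_of_pos hq2]
  congr 1
  ring

end Summit.NavierStokesRegularity.NavierStokesRegularity.Theorems.PowerGaugeEulerLiouville.NeedleClock

end
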